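import Mathlib
import HarnessLib
import Summits.HubbardSuperconductivity.HubbardSuperconductivity.Theorems.KLProgrammeC4aCooperDefectMixed

/-!
# Route `KLProgramme` — crux C4a, S3 brick (B4) «(U1)-HYBRID» part D-3b: THE MIXED COOPER DEFECT OF THE pp PARTNER BAND — `|∂_φ𝒜_φ| ≤ K₂msD₁‖S′‖ + (K₃msD₁² + K₂msD₂)‖S‖`

Cell `gate-hubbard-kl`, seat hubbard-kl-k3c3-p3 (g36; row «implicit-function / monotonicity route for μ(n)»).  Located brick for the (C)-closer lane / the (M4)
assembly of the first-order ϑ-layer (stub (C) `stub_twoLeg_curvature` of `KLRegimeEngineV17F2`, stmt-HubbardSuperconductivity-20437), memo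
HOME/hubbard-kl-k3c3-p3/U1-CAUSTIC-SUP.md §19 (D-3).

WHY.  The pp instance of `…C4aCooperDefectMixed.abs_deriv_anisotropy_le_cooper` with `γ(φ) := Φ(e, φ+θ)` (`e_K(−Φ(e,·)) ≡ e` by `frameLevel_neg_levelPoint_tube`, frame
table `‖γ′‖ ≤ msD₁`, `‖γ″‖ ≤ msD₂`), for the pair momentum `S` and its base-angle velocity `S′` of ANY configuration: the loop-angle derivative of the anisotropy-defect
expression `φ ↦ De_K(S − Φ(e,φ+θ))[S′ − ∂_sΦ(e,φ+θ)]` is `≤ K₂msD₁‖S′‖ + (K₃msD₁² + K₂msD₂)‖S‖` — both `≲ |ρ| + |ϑ − π|` near the Cooper configuration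
(`…C4aPathRigidity`), i.e. the `H₁ ≲ s` row of the near-(C) ratio-form key lemma.
* **`abs_deriv_anisotropy_pp_le_cooper`**.
Sizes binder shape; pure calculus; nothing asserts (C), K3 or superconductivity.
References: FST II CPAM 51 (1998) §3 Thm 3.5 [cite: FeldmanSalmhoferTrubowitz1998]; BGM 2006 §2.4 [cite: BenfattoGiulianiMastropietro2006].
-/

noncomputable section

namespace Summit.HubbardSuperconductivity.HubbardSuperconductivity.Theorems.C4a

set_option linter.dupNamespace false -- summit = problem name (single-conjunct summit), D-0017

open Real Set Filter
open scoped Topology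
open Literature.MathematicalPhysics.QuantumLattice Literature.MathematicalPhysics.QuantumLattice.BandSectorCounting Literature.Probability.LatticeModels
open Summit.HubbardSuperconductivity.HubbardSuperconductivity.Theorems.KLRegimeSplit
open Summit.HubbardSuperconductivity.HubbardSuperconductivity.Theorems.DispersionFlow
open Summit.HubbardSuperconductivity.HubbardSuperconductivity.Theorems.PerturbedFermiCurve

section Sizes

variable {K : TrigPolyC4v} {A : ℝ} (hA : ∀ p : Momentum, ∀ j ≤ 2, ‖iteratedFDeriv ℝ j (frameShift K) p‖ ≤ A) (hA20 : A ≤ 1 / 20)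
  (hd : klCurveD ≤ (bandBounds (show (-4 : ℝ) < -1.1 by norm_num) (show (-1.1 : ℝ) ≤ -0.1 by norm_num)
    (show (-0.1 : ℝ) < 0 by norm_num)).Dtmin - 2 * A)
  {μ r : ℝ} (hr : 0 < r) (hlo : (-1.1 : ℝ) < μ - r - A) (hhi : μ + r + A < -0.1)
  {A₃ A₄ : ℝ} (hA₃ : ∀ p : Momentum, ‖iteratedFDeriv ℝ 3 (frameShift K) p‖ ≤ A₃)
  (hA₄ : ∀ p : Momentum, ‖iteratedFDeriv ℝ 4 (frameShift K) p‖ ≤ A₄)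
  {K₂ K₃ : ℝ} (hK₂ : ∀ p : Momentum, ‖iteratedFDeriv ℝ 2 (frameLevel μ K) p‖ ≤ K₂) (hK₃ : ∀ p : Momentum, ‖iteratedFDeriv ℝ 3 (frameLevel μ K) p‖ ≤ K₃)
include hA hA20 hd hr hlo hhi hA₃ hA₄ hK₂ hK₃

omit hr in
/-- **THE MIXED COOPER DEFECT OF THE pp PARTNER BAND** (see the module docstring). -/
theorem abs_deriv_anisotropy_pp_le_cooper {e : ℝ} (he : |e| < r) (θ : ℝ) (S Sp : Momentum) (φ : ℝ) :
    |deriv (fun x : ℝ => (fderiv ℝ (frameLevel μ K) (S - levelPoint μ K e (x + θ)))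
        (Sp - deriv (fun y : ℝ => levelPoint μ K e (y + θ)) x)) φ| ≤
      K₂ * msD A₃ A₄ 1 * ‖Sp‖ + (K₃ * msD A₃ A₄ 1 ^ 2 + K₂ * msD A₃ A₄ 2) * ‖S‖ := by
  have hγ : ContDiff ℝ 2 (fun x : ℝ => levelPoint μ K e (x + θ)) :=
    (contDiff_levelPoint_of_sizes hA hd hlo hhi he 2).comp (contDiff_id.add contDiff_const)
  have href : ∀ x : ℝ, frameLevel μ K (-levelPoint μ K e (x + θ)) = e := fun x => frameLevel_neg_levelPoint_tube hA hlo hhi he (x + θ)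
  have hm₁ : ‖deriv (fun y : ℝ => levelPoint μ K e (y + θ)) φ‖ ≤ msD A₃ A₄ 1 := by
    have h : deriv (fun y : ℝ => levelPoint μ K e (y + θ)) φ = iteratedDeriv 1 (levelPoint μ K e) (φ + θ) := by
      rw [iteratedDeriv_one, ← iteratedDeriv_one, ← iteratedDeriv_one]
      exact congrFun (iteratedDeriv_comp_add_const 1 (levelPoint μ K e) θ) φ
    rw [h]; exact norm_iteratedDeriv_levelPoint_le hA hA20 hd hlo hhi hA₃ hA₄ he le_rfl (by norm_num) (φ + θ)
  have hm₂ : ‖iteratedDeriv 2 (fun y : ℝ => levelPoint μ K e (y + θ)) φ‖ ≤ msD A₃ A₄ 2 := by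
    rw [congrFun (iteratedDeriv_comp_add_const 2 (levelPoint μ K e) θ) φ]
    exact norm_iteratedDeriv_levelPoint_le hA hA20 hd hlo hhi hA₃ hA₄ he (i := 2) (by norm_num) (by norm_num) (φ + θ)
  have h := abs_deriv_anisotropy_le_cooper (EngineV8.contDiff_frameLevel μ K (n := 3)) hK₂ hK₃ hγ href S Sp le_rfl le_rfl hm₁ hm₂
  calc _ ≤ K₂ * msD A₃ A₄ 1 * ‖Sp‖ + (K₃ * msD A₃ A₄ 1 ^ 2 + K₂ * msD A₃ A₄ 2) * ‖S‖ := h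

end Sizes

end Summit.HubbardSuperconductivity.HubbardSuperconductivity.Theorems.C4a

end
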